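import Summits.BirchSwinnertonDyer.BirchSwinnertonDyer.Theorems.AlignedTransportAtTwoBSDOfMainConjectureRankOneAtTwoEulerCharAtTwoCell
import Summits.BirchSwinnertonDyer.Rank1Residual.X5.RationalTwoTorsionPoints
import Literature.NumberTheory.EllipticCurves.Greenberg1999.NoProperFiniteIndexSubmodule
import Literature.NumberTheory.EllipticCurves.Rank1Residual.PrintShape
import HarnessLib

/-!
# Route `AlignedTransportAtTwo`, crux C3′ `BSDOfMainConjectureRankOneAtTwo` (stmt-BirchSwinnertonDyer-23008) — ON THE CELL the Bockstein map
# `φ_X : X[T] → X/TX` of `X(E/ℚ_∞)` is INJECTIVE (Hachimori–Matsuno / Greenberg Prop. 4.14 at `2`, PRINT) and `E(ℚ)(2) = 0`, so the residual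
# is ONE INDEX: `#coker φ_X · log₂ 5 = u · Reg₂ · #Ш(E/ℚ)(2) · 2^{v₂(∏c_v)} · #Ẽ(𝔽₂)(2)²`

HONEST FRAMING (cell `bsd-f1-sign2`, WIDTH-5 attach seat `bsd-line-att-p4` g6 under the C3′ lead lineage `bsd-line-att-p1`;
`--supports stmt-BirchSwinnertonDyer-23008 --as helper`). BSD is NOT proved; C3′ is NOT closed; nothing is asserted. THEOREMS ONLY (no `def`,
no named fact, no `sorry`). Companion of p624996 (`…EulerCharAtTwo`: the open stub ⟺ the `Γ`-Euler-characteristic statement at `2`) and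
p625448 (`…EulerCharAtTwoCell`: on the cell `ker φ_X`, `coker φ_X` are finite; the VALUE ⟺ `BSDp W 2`).

WHAT IS PROVED (all modulo PRINT named facts, displayed as hypotheses, and the crux's own binders):
* §1 `not_two_dvd_torsionOrder_of_forall_not_hasRationalTwoTorsionX`, `natCard_primaryComponent_point_eq_one_of_not_dvd` — the cell binder «no rational
  `2`-torsion abscissa» gives `2 ∤ #E(ℚ)_tors` and `#E(ℚ)(2) = 1` (Cauchy in `E(ℚ)_tors`; `E[2]` irreducible, `…AlignedTransportAtTwoSeed`).
* §2 `ker_bockstein_eq_bot_of_cell` — ON THE C3′ CELL (good ordinary at `2`, no rational `2`-torsion, `r_an = 1`, simple zero of `L₂(f_E)`,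
  `MazurMainConjecture W 2`), modulo Gross–Zagier–Kolyvagin, modularity AND Greenberg's Prop. 4.14 at `p = 2` = Hachimori–Matsuno 2000 Cor. (i)
  (`Greenberg1999.prop414_noFiniteSubmodule_of_not_dvd_torsionOrder`, PRINT for EVERY `p` and every `ℤ_p`-extension — Cassels–Tate proof; «`X`
  torsion and `E(K)` has no element of order `p` ⟹ `X` has no non-zero finite `Λ`-submodule»): **`ker φ_X = 0`** — `ker φ_X` is a finite
  (p625448 §2) `Λ`-submodule of `X`, hence zero. So Li–Tian–Yan–Zhu 2025 §1.2's obstacle «Mazur's no-finite-submodule theorem holds only for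
  `p ≠ 2`» is NOT an obstacle on this cell: the needed statement at `2` is Hachimori–Matsuno's, whose hypothesis `E(ℚ)[2] = 0` is a cell binder.
* §3 `eulerCharValueAt_iff_index_of_cell` — hence ON THE CELL the Euler-characteristic VALUE statement for `W` (p625448 §4's left side) is
  EQUIVALENT to the ONE-INDEX statement «for every cyclotomic datum, every f.g. torsion strict dual `X`, THE `Σ²` height `Dh`, given `Reg₂ ≠ 0`
  and `Ш(2)` finite: `#coker φ_X · log₂ 5 = u · Reg₂(Dh) · #Ш(E/ℚ)(2) · 2^{v₂(∏c_v)} · #Ẽ(𝔽₂)(2)²`» (`rank = 1` by GZK, `#ker φ_X = 1`, `#E(ℚ)(2) = 1`),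
  and `index_iff_bsdp_of_cell` — that index statement ⟺ `BSDp W 2` (with p625448 §4). READING: what C3′ needs beyond print is EXACTLY the
  `2`-adic valuation of ONE index, `[X/TX : image of X[T]]` for `X = X(E/ℚ_∞)` strict at `∞`, curve by curve on the cell.

References: [HachimoriMatsuno2000] Cor. (i); [GreenbergLNM1716] Prop. 4.14; [CoatesSchneiderSujatha2003] p. 204; [LiTianYanZhu2025] §1.2;
[GrossZagier1986]; [Kolyvagin1990]; [Disegni2020] Thm. 1; [Miller2011LMS] Def. 1.1.
-/

set_option autoImplicit false
-- the route's Theorems namespace repeats a component by design (summit = sub-problem, D-0017).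
set_option linter.dupNamespace false

noncomputable section

open scoped Classical MatrixGroups ModularForm

open CongruenceSubgroup WeierstrassCurve Literature.NumberTheory.EllipticCurves Literature.NumberTheory.EllipticCurves.IwasawaAlgebra
  Literature.NumberTheory.EllipticCurves.ModularForms Literature.NumberTheory.EllipticCurves.Greenberg1999
  Summit.BirchSwinnertonDyer.Rank1Residual.F1Sign2
  Summit.BirchSwinnertonDyer.BirchSwinnertonDyer.Theorems.Rank1ResidualX1Defs
  Summit.BirchSwinnertonDyer.BirchSwinnertonDyer.Theorems.AlignedTransportAtTwoEulerCharAtTwo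
  Summit.BirchSwinnertonDyer.BirchSwinnertonDyer.Theorems.AlignedTransportAtTwoEulerCharAtTwoCell

namespace Summit.BirchSwinnertonDyer.BirchSwinnertonDyer.Theorems.AlignedTransportAtTwoEulerCharAtTwoCellIndex

/-! ## §1 The cell binder «no rational `2`-torsion»: `2 ∤ #E(ℚ)_tors`, `#E(ℚ)(2) = 1` -/

/-- **No rational `2`-torsion abscissa ⟹ `2 ∤ #E(ℚ)_tors`**: `E[2]` is then irreducible and an irreducible `E[p]` forces `ord_p #E(ℚ)_tors = 0`
(`Rank1Residual.padicValNat_torsionOrder_eq_zero_of_irreducible`, Cauchy). [cite: SilvermanAEC2009, III.2.3 and VIII.7] -/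
theorem not_two_dvd_torsionOrder_of_forall_not_hasRationalTwoTorsionX (W : WeierstrassCurve ℚ) [W.IsElliptic]
    (ht : ∀ x : ℚ, ¬ HasRationalTwoTorsionX W x) : ¬ 2 ∣ W.torsionOrder := by
  intro hdvd
  -- `E[2]` is irreducible: a rational point `P = (x, y)` of order `2` would give `2y + a₁x + a₃ = 0`, i.e. `HasRationalTwoTorsionX W x`
  -- (the computation of `…Theorems.AlignedTransportAtTwoSeed.irr_two_of_forall_not_hasRationalTwoTorsionX`, p583329, inlined to keep
  -- this helper route-independent).
  have hirr : Literature.NumberTheory.EllipticCurves.Rank1Residual.Irr W 2 := by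
    rw [Summit.BirchSwinnertonDyer.Rank1Residual.X5.O1.irr_two_iff_not_exists_addOrderOf_eq_two]
    rintro ⟨P, hP⟩
    have h2 : (2 : ℕ) • P = 0 := by rw [← hP]; exact addOrderOf_nsmul_eq_zero P
    have hP0 : P ≠ 0 := by
      rintro rfl
      rw [addOrderOf_zero] at hP
      exact absurd hP (by norm_num)
    rcases P with _ | ⟨x, y, hns⟩
    · exact absurd rfl hP0
    · refine ht x ⟨y, hns.1, ?_⟩
      have hneg : (WeierstrassCurve.Affine.Point.some x y hns : W.toAffine.Point) =
          -WeierstrassCurve.Affine.Point.some x y hns :=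
        eq_neg_of_add_eq_zero_left (by rwa [two_nsmul] at h2)
      rw [WeierstrassCurve.Affine.Point.neg_some, WeierstrassCurve.Affine.Point.some.injEq] at hneg
      have hy : y = -y - W.a₁ * x - W.a₃ := hneg.2
      linear_combination hy
  have h0 := Literature.NumberTheory.EllipticCurves.Rank1Residual.padicValNat_torsionOrder_eq_zero_of_irreducible W 2 hirr
  rw [padicValNat.eq_zero_iff] at h0
  rcases h0 with h | h | h
  · exact absurd h (by norm_num)
  · exact W.torsionOrder_pos_holds.ne' h
  · exact h hdvd

/-- **`p ∤ #E(K)_tors ⟹ #E(K)(p) = 1`** (any number field `K`, any prime `p`): the `p`-primary component of `E(K)` lies in the (finite)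
torsion subgroup, where an element of order `pⁿ` forces `pⁿ ∣ #E(K)_tors`, so `n = 0`. [cite: SilvermanAEC2009, VIII.7] -/
theorem natCard_primaryComponent_point_eq_one_of_not_dvd {K : Type*} [Field K] [NumberField K] (V : WeierstrassCurve K)
    [V.IsElliptic] (p : ℕ) [Fact p.Prime] (h : ¬ p ∣ V.torsionOrder) :
    Nat.card (AddCommGroup.primaryComponent V.toAffine.Point p) = 1 := by
  haveI : Finite (AddCommGroup.torsion V.toAffine.Point) := V.finite_torsion_point
  rw [natCard_primaryComponent_point_eq_torsion V p]
  haveI : Subsingleton (AddCommGroup.primaryComponent (AddCommGroup.torsion V.toAffine.Point) p) := by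
    refine ⟨fun a b ↦ ?_⟩
    suffices hz : ∀ c : AddCommGroup.primaryComponent (AddCommGroup.torsion V.toAffine.Point) p, c = 0 by
      rw [hz a, hz b]
    intro c
    obtain ⟨n, hn⟩ := (AddCommGroup.mem_primaryComponent).mp c.2
    have hdvd : addOrderOf (c : AddCommGroup.torsion V.toAffine.Point) ∣ V.torsionOrder :=
      addOrderOf_dvd_natCard _
    have hord : addOrderOf (c : AddCommGroup.torsion V.toAffine.Point) ∣ p ^ n := addOrderOf_dvd_of_nsmul_eq_zero hn
    obtain ⟨k, -, hkeq⟩ := (Nat.dvd_prime_pow (Fact.out : p.Prime)).mp hord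
    have hdvd' : p ^ k ∣ V.torsionOrder := by rwa [hkeq] at hdvd
    have hk0 : k = 0 := by
      by_contra hne
      exact h (dvd_trans (dvd_pow_self p hne) hdvd')
    rw [hk0, pow_zero, AddMonoid.addOrderOf_eq_one_iff] at hkeq
    exact Subtype.ext hkeq
  exact Nat.card_of_subsingleton (0 : AddCommGroup.primaryComponent (AddCommGroup.torsion V.toAffine.Point) p)

/-! ## §2 On the cell `φ_X` is injective (Hachimori–Matsuno / Greenberg Prop. 4.14 at `2`) -/

/-- **`ker φ_X = 0` on the C3′ cell (CONDITIONAL on the displayed PRINT facts; closes nothing).** For `W` globally minimal, good ordinary at `2`,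
with no rational `2`-torsion abscissa, analytic rank one, a simple zero of `L₂(f_E)` at `T = 0` for every conductor-level newform and
`MazurMainConjecture W 2`, and modulo Gross–Zagier–Kolyvagin (`hGZK`), modularity (`hmod`) and Greenberg's Prop. 4.14 / Hachimori–Matsuno
Cor. (i) at `p = 2` (`h414`): for every cyclotomic datum and every Pontryagin-dual datum `D` with `X = D.X` finitely generated, the Bockstein
map `φ_X : X[T] → X/TX` is injective. (`ker φ_X` is finite by `…EulerCharAtTwoCell.finite_bockstein_of_cell`; it is a `Λ`-submodule of the
torsion module `X`; `2 ∤ #E(ℚ)_tors` by §1; Prop. 4.14 kills it.) [cite: HachimoriMatsuno2000, Cor. (i)] [cite: GreenbergLNM1716, Prop. 4.14] -/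
theorem ker_bockstein_eq_bot_of_cell (h414 : prop414_noFiniteSubmodule_of_not_dvd_torsionOrder)
    (hGZK : rank_eq_analyticRank_of_analyticRank_le_one) (hmod : nonempty_modularParametrizationData)
    (W : WeierstrassCurve ℚ) [W.IsElliptic] [W.IsGloballyMinimal] (hord : IsOrdinaryAt W 2)
    (ht : ∀ x : ℚ, ¬ HasRationalTwoTorsionX W x) (hr : W.analyticRank = 1)
    (hL : ∀ [NeZero (W.conductorNorm ℤ)] (f : CuspForm (Gamma0 (W.conductorNorm ℤ)) 2), IsNewformOf W f →
      (padicLFunction f (unitRoot W 2 : ℚ_[2])).order = 1)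
    (hMC : MazurMainConjecture W 2) {κ : ZpExtension ℚ 2} {γ : Field.absoluteGaloisGroup ℚ}
    (hκ : κ.IsCyclotomic) (hγ : κ.IsTopGenerator γ) (hγ' : IsCyclotomicVariable 2 γ)
    (D : W.SelmerDualData κ γ) [Module.Finite (IwasawaAlgebra 2) D.X] :
    LinearMap.ker (bockstein 2 D.X) = ⊥ := by
  obtain ⟨hX, -, hfin, -⟩ := finite_bockstein_of_cell hGZK hmod W hord hr hL hMC hκ hγ hγ' D
  have h2 := not_two_dvd_torsionOrder_of_forall_not_hasRationalTwoTorsionX W ht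
  -- push `ker φ_X ≤ X[T]` into `X`
  set N : Submodule (IwasawaAlgebra 2) D.X := (LinearMap.ker (bockstein 2 D.X)).map (invariants 2 D.X).subtype with hN
  haveI : Finite N := by
    haveI := hfin
    exact Finite.of_surjective (fun x : LinearMap.ker (bockstein 2 D.X) ↦
      (⟨(invariants 2 D.X).subtype x, Submodule.mem_map_of_mem x.2⟩ : N)) fun y ↦ by
        obtain ⟨x, hx, hxy⟩ := Submodule.mem_map.mp y.2
        exact ⟨⟨x, hx⟩, Subtype.ext hxy⟩
  have hbot : N = ⊥ := h414 W 2 h2 κ γ hκ hγ D hX N ‹_›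
  rw [hN] at hbot
  -- `subtype` is injective, so `map subtype` is injective on submodules
  exact Submodule.map_injective_of_injective (Submodule.subtype_injective _) (hbot.trans (Submodule.map_bot _).symm)

/-- On the cell, `#ker φ_X = 1`. [cite: HachimoriMatsuno2000, Cor. (i)] -/
theorem natCard_ker_bockstein_eq_one_of_cell (h414 : prop414_noFiniteSubmodule_of_not_dvd_torsionOrder)
    (hGZK : rank_eq_analyticRank_of_analyticRank_le_one) (hmod : nonempty_modularParametrizationData)
    (W : WeierstrassCurve ℚ) [W.IsElliptic] [W.IsGloballyMinimal] (hord : IsOrdinaryAt W 2)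
    (ht : ∀ x : ℚ, ¬ HasRationalTwoTorsionX W x) (hr : W.analyticRank = 1)
    (hL : ∀ [NeZero (W.conductorNorm ℤ)] (f : CuspForm (Gamma0 (W.conductorNorm ℤ)) 2), IsNewformOf W f →
      (padicLFunction f (unitRoot W 2 : ℚ_[2])).order = 1)
    (hMC : MazurMainConjecture W 2) {κ : ZpExtension ℚ 2} {γ : Field.absoluteGaloisGroup ℚ}
    (hκ : κ.IsCyclotomic) (hγ : κ.IsTopGenerator γ) (hγ' : IsCyclotomicVariable 2 γ)
    (D : W.SelmerDualData κ γ) [Module.Finite (IwasawaAlgebra 2) D.X] :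
    Nat.card (LinearMap.ker (bockstein 2 D.X)) = 1 := by
  rw [ker_bockstein_eq_bot_of_cell h414 hGZK hmod W hord ht hr hL hMC hκ hγ hγ' D]
  exact Nat.card_unique

/-! ## §3 On the cell the residual is ONE index -/

/-- **On the C3′ cell the Euler-characteristic VALUE statement is the ONE-INDEX statement (CONDITIONAL on the displayed PRINT facts; closes
nothing).** Same cell binders and PRINT inputs as §2. The VALUE statement for `W` (left side of `…EulerCharAtTwoCell.eulerCharValueAt_iff_bsdp`:
`#coker φ_X·(log₂ 5)^r·#E(ℚ)(2)² = u·#ker φ_X·Reg₂·#Ш(2)·2^{v₂(∏c_v)}·#Ẽ(𝔽₂)(2)²` for every datum, given `Reg₂ ≠ 0`, `Ш(2)` finite) holds IFF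
the INDEX statement holds: for every cyclotomic datum, every finitely generated torsion strict dual `X`, THE `Σ²` height `Dh`, given
`Reg₂(Dh) ≠ 0` and `Ш(2)` finite, **`#coker φ_X · log₂ 5 = u · Reg₂(Dh) · #Ш(E/ℚ)(2) · 2^{v₂(∏c_v)} · #Ẽ(𝔽₂)(2)²`** — because on the cell
`rank E(ℚ) = 1` (GZK), `#ker φ_X = 1` (§2) and `#E(ℚ)(2) = 1` (§1). [cite: HachimoriMatsuno2000, Cor. (i)] [cite: CoatesSchneiderSujatha2003, p. 204] -/
theorem eulerCharValueAt_iff_index_of_cell (h414 : prop414_noFiniteSubmodule_of_not_dvd_torsionOrder)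
    (hGZK : rank_eq_analyticRank_of_analyticRank_le_one) (hmod : nonempty_modularParametrizationData)
    (W : WeierstrassCurve ℚ) [W.IsElliptic] [W.IsGloballyMinimal] (hord : IsOrdinaryAt W 2)
    (ht : ∀ x : ℚ, ¬ HasRationalTwoTorsionX W x) (hr : W.analyticRank = 1)
    (hL : ∀ [NeZero (W.conductorNorm ℤ)] (f : CuspForm (Gamma0 (W.conductorNorm ℤ)) 2), IsNewformOf W f →
      (padicLFunction f (unitRoot W 2 : ℚ_[2])).order = 1)
    (hMC : MazurMainConjecture W 2) :
    (∀ (κ : ZpExtension ℚ 2) (γ : Field.absoluteGaloisGroup ℚ),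
        κ.IsCyclotomic → κ.IsTopGenerator γ → IsCyclotomicVariable 2 γ →
      ∀ (D : W.SelmerDualData κ γ) [Module.Finite (IwasawaAlgebra 2) D.X], D.IsTorsion →
      ∀ (Dh : PAdicHeightData W 2), Dh.IsCanonicalSq →
        SchneiderConjecture Dh → Finite (AddCommGroup.primaryComponent W.sha 2) →
        ∃ u : ℤ_[2]ˣ,
          (Nat.card (coinvariants 2 D.X ⧸ LinearMap.range (bockstein 2 D.X)) : ℚ_[2]) *
              padicLog 2 (cyclotomicGenerator 2) ^ W.mordellWeilRank *
              (Nat.card (AddCommGroup.primaryComponent W.toAffine.Point 2) : ℚ_[2]) ^ 2 =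
            ((u : ℤ_[2]) : ℚ_[2]) * Nat.card (LinearMap.ker (bockstein 2 D.X)) * padicRegulator Dh *
              Nat.card (AddCommGroup.primaryComponent W.sha 2) * (2 : ℚ_[2]) ^ (padicValNat 2 W.tamagawaProduct) *
              (Nat.card (AddCommGroup.primaryComponent
                ((integralModelInt W).map (Int.castRingHom (ZMod 2))).toAffine.Point 2) : ℚ_[2]) ^ 2) ↔
    (∀ (κ : ZpExtension ℚ 2) (γ : Field.absoluteGaloisGroup ℚ),
        κ.IsCyclotomic → κ.IsTopGenerator γ → IsCyclotomicVariable 2 γ →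
      ∀ (D : W.SelmerDualData κ γ) [Module.Finite (IwasawaAlgebra 2) D.X], D.IsTorsion →
      ∀ (Dh : PAdicHeightData W 2), Dh.IsCanonicalSq →
        SchneiderConjecture Dh → Finite (AddCommGroup.primaryComponent W.sha 2) →
        ∃ u : ℤ_[2]ˣ,
          (Nat.card (coinvariants 2 D.X ⧸ LinearMap.range (bockstein 2 D.X)) : ℚ_[2]) * padicLog 2 (cyclotomicGenerator 2) =
            ((u : ℤ_[2]) : ℚ_[2]) * padicRegulator Dh * Nat.card (AddCommGroup.primaryComponent W.sha 2) *
              (2 : ℚ_[2]) ^ (padicValNat 2 W.tamagawaProduct) *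
              (Nat.card (AddCommGroup.primaryComponent
                ((integralModelInt W).map (Int.castRingHom (ZMod 2))).toAffine.Point 2) : ℚ_[2]) ^ 2) := by
  have hrank1 : W.mordellWeilRank = 1 := by rw [(hGZK W (le_of_eq hr)).1, hr]
  have hTp : (Nat.card (AddCommGroup.primaryComponent W.toAffine.Point 2) : ℚ_[2]) = 1 := by
    have h := natCard_primaryComponent_point_eq_one_of_not_dvd W 2
      (not_two_dvd_torsionOrder_of_forall_not_hasRationalTwoTorsionX W ht)
    exact_mod_cast (natCard_primaryComponent_point_congr W 2 _ _).trans h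
  have hK : ∀ {κ : ZpExtension ℚ 2} {γ : Field.absoluteGaloisGroup ℚ}, κ.IsCyclotomic → κ.IsTopGenerator γ →
      IsCyclotomicVariable 2 γ → ∀ (D : W.SelmerDualData κ γ) [Module.Finite (IwasawaAlgebra 2) D.X],
      (Nat.card (LinearMap.ker (bockstein 2 D.X)) : ℚ_[2]) = 1 := by
    intro κ γ hκ hγ hγ' D _
    exact_mod_cast natCard_ker_bockstein_eq_one_of_cell h414 hGZK hmod W hord ht hr hL hMC hκ hγ hγ' D
  constructor
  · intro h κ γ hκ hγ hγ' D _ hX Dh hDh hS hSha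
    obtain ⟨u, hu⟩ := h κ γ hκ hγ hγ' D hX Dh hDh hS hSha
    refine ⟨u, ?_⟩
    rw [hrank1, pow_one, hTp, hK hκ hγ hγ' D] at hu
    linear_combination hu
  · intro h κ γ hκ hγ hγ' D _ hX Dh hDh hS hSha
    obtain ⟨u, hu⟩ := h κ γ hκ hγ hγ' D hX Dh hDh hS hSha
    refine ⟨u, ?_⟩
    rw [hrank1, pow_one, hTp, hK hκ hγ hγ' D]
    linear_combination hu

/-- **TIGHTNESS in the one-index currency (CONDITIONAL on the displayed PRINT facts; closes nothing).** On the C3′ cell, modulo Disegni 2020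
Thm. 1 (`hD`), GZK, modularity, Mazur–Tate `Σ²` at `2` (`hMT`) and Greenberg Prop. 4.14 / Hachimori–Matsuno at `2` (`h414`): the ONE-INDEX
statement «`#coker(X[T] ↪ X/TX) · log₂ 5 = u · Reg₂ · #Ш(E/ℚ)(2) · 2^{v₂(∏c_v)} · #Ẽ(𝔽₂)(2)²` for every datum and THE `Σ²` height, given
`Reg₂ ≠ 0`, `Ш(2)` finite» holds IF AND ONLY IF `BSDp W 2`. So what the crux needs beyond print, curve by curve, is the `2`-adic size of ONE
index of `X(E/ℚ_∞)`. [cite: HachimoriMatsuno2000, Cor. (i)] [cite: Disegni2020, Thm. 1] [cite: Miller2011LMS, Def. 1.1] -/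
theorem index_iff_bsdp_of_cell (h414 : prop414_noFiniteSubmodule_of_not_dvd_torsionOrder)
    (hD : Disegni2020.padicBSD_goodOrd_rankOne)
    (hGZK : rank_eq_analyticRank_of_analyticRank_le_one) (hmod : nonempty_modularParametrizationData)
    (hMT : mazurTate_sigmaSq_existsUnique_two)
    (W : WeierstrassCurve ℚ) [W.IsElliptic] [W.IsGloballyMinimal] (hord : IsOrdinaryAt W 2)
    (ht : ∀ x : ℚ, ¬ HasRationalTwoTorsionX W x) (hr : W.analyticRank = 1)
    (hL : ∀ [NeZero (W.conductorNorm ℤ)] (f : CuspForm (Gamma0 (W.conductorNorm ℤ)) 2), IsNewformOf W f →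
      (padicLFunction f (unitRoot W 2 : ℚ_[2])).order = 1)
    (hMC : MazurMainConjecture W 2) :
    (∀ (κ : ZpExtension ℚ 2) (γ : Field.absoluteGaloisGroup ℚ),
        κ.IsCyclotomic → κ.IsTopGenerator γ → IsCyclotomicVariable 2 γ →
      ∀ (D : W.SelmerDualData κ γ) [Module.Finite (IwasawaAlgebra 2) D.X], D.IsTorsion →
      ∀ (Dh : PAdicHeightData W 2), Dh.IsCanonicalSq →
        SchneiderConjecture Dh → Finite (AddCommGroup.primaryComponent W.sha 2) →
        ∃ u : ℤ_[2]ˣ,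
          (Nat.card (coinvariants 2 D.X ⧸ LinearMap.range (bockstein 2 D.X)) : ℚ_[2]) * padicLog 2 (cyclotomicGenerator 2) =
            ((u : ℤ_[2]) : ℚ_[2]) * padicRegulator Dh * Nat.card (AddCommGroup.primaryComponent W.sha 2) *
              (2 : ℚ_[2]) ^ (padicValNat 2 W.tamagawaProduct) *
              (Nat.card (AddCommGroup.primaryComponent
                ((integralModelInt W).map (Int.castRingHom (ZMod 2))).toAffine.Point 2) : ℚ_[2]) ^ 2) ↔
    BSDp W 2 := by
  rw [← eulerCharValueAt_iff_index_of_cell h414 hGZK hmod W hord ht hr hL hMC]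
  exact eulerCharValueAt_iff_bsdp hD hGZK hmod hMT W hord hr hL hMC

end Summit.BirchSwinnertonDyer.BirchSwinnertonDyer.Theorems.AlignedTransportAtTwoEulerCharAtTwoCellIndex

end
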